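import Summits.ResolutionOfSingularities.ResolutionOfSingularities.Theorems.WildTwistedToricLU6
import HarnessLib

/-!
# WildTwistedToricLU (7/7) — KERNEL TOY DATA (`p = 2, 3`), the located residual `R34`, the cut `R33 ↔ R34`, ROOT BY NAME

Node «TwistedToricCut» (decomp-res lens-1 g33), tree file 7/7.

* TOY (depth-1 registry control `B′ = k[η, u₁]_{(η,u₁)}`, `σ η = η/(1 + η)`, `σ u₁ = u₁ (1 + η)`, ANY `p`): the
  `σ`-orbits `toyEta η i = σⁱη = η/(1 + iη)`, `toyUnit η i = σⁱ(1 + η)`, `toyU1 η u₁ i = σⁱ u₁`, as honest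
  recursions; KERNEL DATA for `p = 2` and `p = 3`: NORM ONE `∏ σⁱ u = 1`, the Hilbert-90 identity `σΦ = Φ u^p` for
  `Φ = ∏ (σⁱu)ⁱ`, invariance of `U = z_{(1,1)} = η u₁`, `s = z_{(p,0)} = η^p Φ`, `n = z_{(0,p)} = u₁^p Φ⁻¹` and the
  relation `U^p = s n` (paper: `B′^σ = k[s,n,U]/(U^p − sn) = A_{p−1}`, SINGULAR — the law's chart picks one of its
  `p` toric charts).
* `R34 := R33 ∧ ¬λ′` (`NonKHToricArchLUKeyHenselDescentQuotTInertTwoMBWildLDTT`), the cell piece (DECIDED by the law),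
  `R33 → R34`, the ONE exact cut `R33 ↔ R34` (case split + the law; the re-locations `R32 ↔ R34`, …, and the
  root-level sigma form follow by `.trans` from g32's and are not restated), `_of_root`, `closes_twistedToric`
  (EXACTLY `closes_logDiag`'s five printed binders with `R33 ↦ R34`).
  HONEST SCOPE: unlike g32's cut, the extra binder `¬ WildLogDiagonalUnluckyAbove k O` is NOT implied by R33's binders —
  `λ′`-places with no pseudo-reflection model (if any: [KiralyLutkebohmert2013, Conj. 10], undecided) are newly
  decided, so `R34` is a CANDIDATE genuine narrowing of the class of places; nothing more is claimed.  The two-pivot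
  kind `λ″ = WildLogDiagonalMixedAbove` is untouched (UNDECIDED); `B^σ` is NOT claimed regular (it is not: `A_{p−1}`).
-/

noncomputable section

open Literature.AlgebraicGeometry.Resolution
open Summit.ResolutionOfSingularities.ResolutionOfSingularities.Theorems.InertDescentLU
open Summit.ResolutionOfSingularities.ResolutionOfSingularities.Theorems.InvariantDescentLU
open Summit.ResolutionOfSingularities.ResolutionOfSingularities.Theorems.WildReflectionLU
open Summit.ResolutionOfSingularities.ResolutionOfSingularities.Theorems.WildLogDiagonalLU

universe u

namespace Summit.ResolutionOfSingularities.ResolutionOfSingularities.Theorems.WildTwistedToricLU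

/-! ## TOY — the depth-1 registry control, kernel data for `p = 2` and `p = 3` -/
section Toy

variable {E : Type u} [Field E]

/-- `σⁱ η` on the control: `σ η = η / (1 + η)` iterated. -/
def toyEta (η : E) : ℕ → E
  | 0 => η
  | i + 1 => toyEta η i / (1 + toyEta η i)

/-- `σⁱ u` for the pivot unit `u = 1 + η`. -/
def toyUnit (η : E) (i : ℕ) : E := 1 + toyEta η i

/-- `σⁱ u₁` on the control: `σ u₁ = u₁ (1 + η)` iterated (`σ^{i+1} u₁ = σⁱu₁ · σⁱu`). -/
def toyU1 (η u₁ : E) : ℕ → E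
  | 0 => u₁
  | i + 1 => toyU1 η u₁ i * toyUnit η i

/-- Closed form `σ η = η/(1 + η)`. -/
theorem toyEta_one (η : E) : toyEta η 1 = η / (1 + η) := rfl

/-- Closed form `σ² η = η/(1 + 2η)`. -/
theorem toyEta_two (η : E) (h1 : 1 + η ≠ 0) : toyEta η 2 = η / (1 + 2 * η) := by
  show toyEta η 1 / (1 + toyEta η 1) = _
  have h : 1 + η / (1 + η) = (1 + 2 * η) / (1 + η) := by
    rw [add_div' _ _ _ h1]; congr 1; ring
  rw [toyEta_one, h, div_div_div_cancel_right₀ h1]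

/-- Closed form `σ³ η = η/(1 + 3η)`. -/
theorem toyEta_three (η : E) (h1 : 1 + η ≠ 0) (h2 : 1 + 2 * η ≠ 0) : toyEta η 3 = η / (1 + 3 * η) := by
  show toyEta η 2 / (1 + toyEta η 2) = _
  have h : 1 + η / (1 + 2 * η) = (1 + 3 * η) / (1 + 2 * η) := by
    rw [add_div' _ _ _ h2]; congr 1; ring
  rw [toyEta_two η h1, h, div_div_div_cancel_right₀ h2]

/-- Closed form `u = 1 + η`. -/
theorem toyUnit_zero (η : E) : toyUnit η 0 = 1 + η := rfl

/-- Closed form `σu = (1 + 2η)/(1 + η)`. -/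
theorem toyUnit_one (η : E) (h1 : 1 + η ≠ 0) : toyUnit η 1 = (1 + 2 * η) / (1 + η) := by
  rw [toyUnit, toyEta_one, add_div' _ _ _ h1]; congr 1; ring

/-- Closed form `σ²u = (1 + 3η)/(1 + 2η)`. -/
theorem toyUnit_two (η : E) (h1 : 1 + η ≠ 0) (h2 : 1 + 2 * η ≠ 0) :
    toyUnit η 2 = (1 + 3 * η) / (1 + 2 * η) := by
  rw [toyUnit, toyEta_two η h1, add_div' _ _ _ h2]; congr 1; ring

/-- Closed form `σ³u = (1 + 4η)/(1 + 3η)`. -/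
theorem toyUnit_three (η : E) (h1 : 1 + η ≠ 0) (h2 : 1 + 2 * η ≠ 0) (h3 : 1 + 3 * η ≠ 0) :
    toyUnit η 3 = (1 + 4 * η) / (1 + 3 * η) := by
  rw [toyUnit, toyEta_three η h1 h2, add_div' _ _ _ h3]; congr 1; ring

/-- **TOY, `p = 2`: NORM ONE** `u · σu = 1` (`= 1 + 2η`). -/
theorem toy_norm_two [CharP E 2] (η : E) (h1 : 1 + η ≠ 0) : toyUnit η 0 * toyUnit η 1 = 1 := by
  have h2 : (2 : E) = 0 := by exact_mod_cast CharP.cast_eq_zero E 2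
  rw [toyUnit_zero, toyUnit_one η h1, mul_div_cancel₀ _ h1]
  linear_combination η * h2

/-- **TOY, `p = 3`: NORM ONE** `u · σu · σ²u = 1` (`= 1 + 3η`). -/
theorem toy_norm_three [CharP E 3] (η : E) (h1 : 1 + η ≠ 0) (h2 : 1 + 2 * η ≠ 0) :
    toyUnit η 0 * toyUnit η 1 * toyUnit η 2 = 1 := by
  have h3 : (3 : E) = 0 := by exact_mod_cast CharP.cast_eq_zero E 3
  rw [toyUnit_zero, toyUnit_one η h1, toyUnit_two η h1 h2, mul_div_cancel₀ _ h1, mul_div_cancel₀ _ h2]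
  linear_combination η * h3

/-- **TOY, `p = 2`: the Hilbert-90 unit** `Φ = ∏_{i<2} (σⁱu)ⁱ = σu` satisfies `σΦ = Φ u²` (`σΦ = σ²u`). -/
theorem toy_twistUnit_two [CharP E 2] (η : E) (h1 : 1 + η ≠ 0) :
    toyUnit η 2 = toyUnit η 1 * toyUnit η 0 ^ 2 := by
  have h2 : (2 : E) = 0 := by exact_mod_cast CharP.cast_eq_zero E 2
  have e2 : (1 : E) + 2 * η = 1 := by rw [h2, zero_mul, add_zero]
  have e3 : (1 : E) + 3 * η = 1 + η := by linear_combination η * h2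
  rw [toyUnit_zero, toyUnit_one η h1, toyUnit_two η h1 (by rw [e2]; exact one_ne_zero), e2, e3, div_one,
    one_div, pow_two, ← mul_assoc, inv_mul_cancel₀ h1, one_mul]

/-- **TOY, `p = 3`: the Hilbert-90 unit** `Φ = σu · (σ²u)²` satisfies `σΦ = Φ u³` (`σΦ = σ²u · (σ³u)²`). -/
theorem toy_twistUnit_three [CharP E 3] (η : E) (h1 : 1 + η ≠ 0) (h2 : 1 + 2 * η ≠ 0) :
    toyUnit η 2 * toyUnit η 3 ^ 2 = (toyUnit η 1 * toyUnit η 2 ^ 2) * toyUnit η 0 ^ 3 := by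
  have h3 : (3 : E) = 0 := by exact_mod_cast CharP.cast_eq_zero E 3
  have e3 : (1 : E) + 3 * η = 1 := by rw [h3, zero_mul, add_zero]
  have e4 : (1 : E) + 4 * η = 1 + η := by linear_combination η * h3
  have h3' : (1 : E) + 3 * η ≠ 0 := by rw [e3]; exact one_ne_zero
  rw [toyUnit_zero, toyUnit_one η h1, toyUnit_two η h1 h2, toyUnit_three η h1 h2 h3', e3, e4, div_one,
    div_eq_mul_inv, div_eq_mul_inv, one_mul]
  have h1i : (1 + η) * (1 + η)⁻¹ = 1 := mul_inv_cancel₀ h1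
  have h2i : (1 + 2 * η) * (1 + 2 * η)⁻¹ = 1 := mul_inv_cancel₀ h2
  linear_combination (-(1 + 2 * η)⁻¹ * (1 + η) ^ 3 * (1 + η)⁻¹) * h2i + (-(1 + 2 * η)⁻¹ * (1 + η) ^ 2) * h1i

/-- **TOY: invariance of `U = z_{(1,1)} = η u₁`** (`σU = ση · σu₁ = U`; any `p`). -/
theorem toy_U_invariant (η u₁ : E) (h1 : 1 + η ≠ 0) : toyEta η 1 * toyU1 η u₁ 1 = η * u₁ := by
  simp only [toyEta, toyU1, toyUnit]
  field_simp

/-- **TOY: the relation `U^p = s · n`** for `s = z_{(p,0)} = η^p Φ`, `n = z_{(0,p)} = u₁^p Φ⁻¹` (any `p`). -/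
theorem toy_relation (p : ℕ) (η u₁ Φ : E) (hΦ : Φ ≠ 0) :
    (η * u₁) ^ p = (η ^ p * Φ) * (u₁ ^ p * Φ⁻¹) := by
  rw [mul_pow]; field_simp

/-- **TOY: invariance of `s = η^p Φ`** (`σs = (ση)^p σΦ`, given `σΦ = Φ u^p`; any `p`). -/
theorem toy_s_invariant (p : ℕ) (η Φ Φ' : E) (h1 : 1 + η ≠ 0) (hσΦ : Φ' = Φ * (1 + η) ^ p) :
    toyEta η 1 ^ p * Φ' = η ^ p * Φ := by
  rw [toyEta_one, hσΦ, div_pow]; field_simp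

/-- **TOY: invariance of `n = u₁^p Φ⁻¹`** (`σn = (σu₁)^p (σΦ)⁻¹`, given `σΦ = Φ u^p`; any `p`). -/
theorem toy_n_invariant (p : ℕ) (η u₁ Φ Φ' : E) (h1 : 1 + η ≠ 0) (hΦ : Φ ≠ 0) (hσΦ : Φ' = Φ * (1 + η) ^ p) :
    toyU1 η u₁ 1 ^ p * Φ'⁻¹ = u₁ ^ p * Φ⁻¹ := by
  simp only [toyU1, toyUnit, toyEta]
  rw [hσΦ, mul_pow]; field_simp

end Toy

/-! ## The located residual `R34`, the cut `R33 ↔ R34`, ROOT BY NAME -/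
section CutTT

open Summit.ResolutionOfSingularities.ResolutionOfSingularities.Theses
open Summit.ResolutionOfSingularities.ResolutionOfSingularities.Theorems
open Summit.ResolutionOfSingularities.ResolutionOfSingularities.Theorems.KeyChainLU
open Summit.ResolutionOfSingularities.ResolutionOfSingularities.Theorems.HenselKeyChainLU
open Summit.ResolutionOfSingularities.ResolutionOfSingularities.Theorems.GaloisDescentLU
open Summit.ResolutionOfSingularities.ResolutionOfSingularities.Theorems.PfaffLine
open Summit.ResolutionOfSingularities.ResolutionOfSingularities.Theorems.ToricLadder
open Summit.ResolutionOfSingularities.ResolutionOfSingularities.Theorems.KaplanskyLadder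
open Summit.ResolutionOfSingularities.ResolutionOfSingularities.Theorems.PerronLadder
open Summit.ResolutionOfSingularities.ResolutionOfSingularities.Theorems.DefectlessLadder
open Summit.ResolutionOfSingularities.ResolutionOfSingularities.Theorems.WCut
open Summit.ResolutionOfSingularities.ResolutionOfSingularities.Theorems.TameQuotientLU
open Summit.ResolutionOfSingularities.ResolutionOfSingularities.Theorems.DecompositionDescentLU
open Summit.ResolutionOfSingularities.ResolutionOfSingularities.Theorems.InertDescentLU
open Summit.ResolutionOfSingularities.ResolutionOfSingularities.Theorems.TameInertialLU
open Summit.ResolutionOfSingularities.ResolutionOfSingularities.Theorems.TameTwoStoreyLU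
open Summit.ResolutionOfSingularities.ResolutionOfSingularities.Theorems.MonomialBlowupLU
open Summit.ResolutionOfSingularities.ResolutionOfSingularities.Theorems.WildReflectionLU

variable {k : Type} [Field k] {K : Type} [Field K] [Algebra k K]

/-- The `λ′` CELL PIECE of the residual family (tag DECIDED by `relLU_of_wildLogDiagonalUnluckyAbove`):
R33's binders together with `λ′` give relative local uniformization. -/
def NonKHToricArchLUKeyHenselDescentQuotTInertTwoMBWildLDTTCell (e c n : ℕ) : Prop :=
  ∀ p : ℕ, p.Prime → ∀ (k K : Type) [Field k] [CharP k p] [Field K] [Algebra k K],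
    Algebra.trdeg k K ≤ n → ∀ O : ValuationSubring K, Nonempty O.valuation.RankOne →
    (∀ y ∈ O, ∃ f : Polynomial k, f ≠ 0 ∧ Polynomial.aeval y f ∈ O.nonunits) →
    ¬ IsAbhyankarPlace O (algebraMap k K).fieldRange ⊤ →
    ¬ (∃ d : ℕ, d < n ∧ SepDenseBelow k O d) → ¬ ToricDenseBelow k O e → ¬ KHTopBelow k O c →
    ¬ KeyChainTopBelow k O → ¬ HenselKeyChainTopBelow k O → ¬ GaloisHenselDescentDatum k O →
    ¬ TameQuotientLU.TameEquivariantLUAbove k O →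
    ¬ DecompositionFieldLUAbove k O → ¬ DecWitnessLUAbove k O → ¬ UnramifiedWitnessLUAbove k O →
    ¬ TameInertialLUAbove k O → ¬ TameOverInertLUAbove k O → ¬ MonomialBlowupAbove k O →
    ¬ WildPseudoReflectionLUAbove k O → ¬ WildLogDiagonalLUAbove k O →
    WildLogDiagonalUnluckyAbove k O → RelLocalUniformization k K O

/-- THE LAW DECIDES THE `λ′` PIECE outright (no port, no fact binder, every `d`, every `p`). [this node] -/
theorem nonKHToricArchLUKeyHenselDescentQuotTInertTwoMBWildLDTTCell_holds (e c n : ℕ) :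
    NonKHToricArchLUKeyHenselDescentQuotTInertTwoMBWildLDTTCell e c n :=
  fun _ _ _ _ _ _ _ _ _ _ _ _ _ _ _ _ _ _ _ _ _ _ _ _ _ _ _ _ hL => relLU_of_wildLogDiagonalUnluckyAbove hL

/-- **NEW LOCATED RESIDUAL `R34`** (tag UNDECIDED · WEAKER than the root · located at `(e, c, n) = (3, 3, 4)`):
R33's clauses AND: for NO Galois `ℤ/p`-layer `K′/K` (`p = char k`) with `G`-stable `O′` and residues in `k` does
every f.g. birational model admit above it a `G`-stable regular f.g. model with a frame on which some `g ∈ G` acts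
binomially log-diagonally with a moved coordinate (the kind `λ′ = WildLogDiagonalUnluckyAbove`, NO luckiness).
KIND CONSUMED hypothesis-free, every `d`, every `p`, by `relLU_of_wildLogDiagonalUnluckyAbove` (the twisted toric
quotient).  HONEST SCOPE OF THE CUT: the new binder `¬ WildLogDiagonalUnluckyAbove k O` is NOT implied by R33's
binders (a `λ′`-model need not be a pseudo-reflection model: on the registry control the quotient of every monomial
chart is the SINGULAR `A_{p−1}`); whether `λ′`-places WITHOUT any pseudo-reflection model exist is
[KiralyLutkebohmert2013, Conj. 10]-adjacent and UNDECIDED here — so `R34` is a CANDIDATE genuine narrowing of the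
class of places, nothing more is claimed.  LOCATED REMAINDER inside the log-diagonal world: (λ″) the two-pivot /
mixed-unit tops `WildLogDiagonalMixedAbove` (cocycle of rank ≥ 2: the additive invariant `1/x₁ − 1/x₂` of the
two-pivot top is not a twisted monomial) — UNDECIDED, untouched; (β′), (β″), (γ), (B′), (α3′) as located in R32/R33.
[cite: KiralyLutkebohmert2013, Thm. 2, Ex. 6, Conj. 10] [cite: CossartPiltant2008, Lemma 9.4] -/
def NonKHToricArchLUKeyHenselDescentQuotTInertTwoMBWildLDTT (e c n : ℕ) : Prop :=
  ∀ p : ℕ, p.Prime → ∀ (k K : Type) [Field k] [CharP k p] [Field K] [Algebra k K],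
    Algebra.trdeg k K ≤ n → ∀ O : ValuationSubring K, Nonempty O.valuation.RankOne →
    (∀ y ∈ O, ∃ f : Polynomial k, f ≠ 0 ∧ Polynomial.aeval y f ∈ O.nonunits) →
    ¬ IsAbhyankarPlace O (algebraMap k K).fieldRange ⊤ →
    ¬ (∃ d : ℕ, d < n ∧ SepDenseBelow k O d) → ¬ ToricDenseBelow k O e → ¬ KHTopBelow k O c →
    ¬ KeyChainTopBelow k O → ¬ HenselKeyChainTopBelow k O → ¬ GaloisHenselDescentDatum k O →
    ¬ TameQuotientLU.TameEquivariantLUAbove k O →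
    ¬ DecompositionFieldLUAbove k O → ¬ DecWitnessLUAbove k O → ¬ UnramifiedWitnessLUAbove k O →
    ¬ TameInertialLUAbove k O → ¬ TameOverInertLUAbove k O → ¬ MonomialBlowupAbove k O →
    ¬ WildPseudoReflectionLUAbove k O → ¬ WildLogDiagonalLUAbove k O → ¬ WildLogDiagonalUnluckyAbove k O →
    RelLocalUniformization k K O

/-- Dropping the negated `λ′` hypothesis: `R33 → R34`. [folklore] -/
theorem nonKHToricArchLUKeyHenselDescentQuotTInertTwoMBWildLDTT_of_logDiag {e c n : ℕ}
    (h : NonKHToricArchLUKeyHenselDescentQuotTInertTwoMBWildLD e c n) :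
    NonKHToricArchLUKeyHenselDescentQuotTInertTwoMBWildLDTT e c n :=
  fun p hp k K _ _ _ _ hd O h1 h0 hA hnd hnt hnk hkey hH hG hT hDF hDW hU hI h2 hMB hW hL _ =>
    h p hp k K hd O h1 h0 hA hnd hnt hnk hkey hH hG hT hDF hDW hU hI h2 hMB hW hL

/-- **THE TWISTED-TORIC CUT** (kernel, exact, hypothesis-free): the g32 located residual `R33` is EQUIVALENT to its
part off the kind `λ′` — on `λ′` the law `relLU_of_wildLogDiagonalUnluckyAbove` decides (case split). [this node] -/
theorem nonKHToricArchLUKeyHenselDescentQuotTInertTwoMBWildLD_iff_twistedToric {e c n : ℕ} :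
    NonKHToricArchLUKeyHenselDescentQuotTInertTwoMBWildLD e c n ↔
      NonKHToricArchLUKeyHenselDescentQuotTInertTwoMBWildLDTT e c n := by
  refine ⟨nonKHToricArchLUKeyHenselDescentQuotTInertTwoMBWildLDTT_of_logDiag,
    fun h p hp k K _ _ _ _ hd O hr hz hA hnd hnt hnk hkey hH hG hT hDF hDW hU hI h2 hMB hW hL => ?_⟩
  by_cases hL' : WildLogDiagonalUnluckyAbove k O
  · exact relLU_of_wildLogDiagonalUnluckyAbove hL'
  exact h p hp k K hd O hr hz hA hnd hnt hnk hkey hH hG hT hDF hDW hU hI h2 hMB hW hL hL'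

/-- The new residual follows from the root outright (it is a WEAKER piece). [folklore] -/
theorem nonKHToricArchLUKeyHenselDescentQuotTInertTwoMBWildLDTT_of_root (hS : _root_.ResolutionOfSingularities)
    (e c n : ℕ) : NonKHToricArchLUKeyHenselDescentQuotTInertTwoMBWildLDTT e c n :=
  nonKHToricArchLUKeyHenselDescentQuotTInertTwoMBWildLDTT_of_logDiag
    (nonKHToricArchLUKeyHenselDescentQuotTInertTwoMBWildLD_of_root hS e c n)

/-- **`closes_twistedToric` — ROOT BY NAME (binders PRINTED, = `closes_logDiag`'s with `R33 ↦ R34`):**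
`(hCP : CossartPiltant2019LU3)` the Cossart–Piltant dimension-3 floor (print) ·
`(hCJS : CossartJannsenSaito2020Embedded)` embedded resolution of excellent surfaces (named fact) ·
`(hAsc : KK05NCVAscent)` the Knaf–Kuhlmann (NC)+(V) ascent Π₁ (print) · `(hN : ∀ d ≥ 4, R34 3 3 d)` the located
residual OFF the twelve cells (…, wild-pseudo-reflection, binomial-log-diagonal AND `λ′`) ·
`(h₃ : Valuative.PatchingRel)` the patching crux 0642 ⇒ `ResolutionOfSingularities`.  All twelve cells are
discharged INSIDE the kernel. [folklore] -/
theorem closes_twistedToric (hCP : CossartPiltant2019LU3.{0}) (hCJS : CossartJannsenSaito2020Embedded.{0})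
    (hAsc : KK05NCVAscent) (hN : ∀ d, 4 ≤ d → NonKHToricArchLUKeyHenselDescentQuotTInertTwoMBWildLDTT 3 3 d)
    (h₃ : Valuative.PatchingRel) : _root_.ResolutionOfSingularities :=
  closes_logDiag hCP hCJS hAsc
    (fun d hd => nonKHToricArchLUKeyHenselDescentQuotTInertTwoMBWildLD_iff_twistedToric.2 (hN d hd)) h₃

end CutTT

end Summit.ResolutionOfSingularities.ResolutionOfSingularities.Theorems.WildTwistedToricLU

end
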